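import Literature.Geometry.Riemannian.GurskyViaclovskyClosednessChartSymbolEuclid
import Literature.Geometry.Riemannian.GurskyViaclovskyClosednessChartBounds
import Literature.Geometry.Riemannian.ChangGurskyYangRegularity
import Literature.Analysis.Calculus.CoordinateJets
import HarnessLib

/-!
# Gursky–Viaclovsky closedness: the chart equation as a jet equation `G(y, t, cjet₂ U(y)) = 0`
# (chart-level bricks of the Schauder bootstrap)

Support file (everything PROVED; no definition, no named fact) for the named fact
`Literature.Geometry.Riemannian.gurskyViaclovsky_pathClosed_weighted_four`
(Gursky–Viaclovsky, J. Differential Geom. 63 (2003), Prop. 6 and §5). The a-priori half of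
Gilbarg–Trudinger's Lemma 17.16 is in the tree in the abstract form
`Literature.Analysis.PDE.uniform_iteratedFDeriv_bounds_of_holder_two`: uniform higher-order bounds
for families of smooth solutions of `G(y, θ_k, cjet₂ u_k(y)) = 0` from uniform `C^{2,α}` bounds,
for a jet function `G` which is `C^∞` in `(y, θ, J) ∈ O × P × CJet ι 2` and uniformly elliptic
along the solutions. This file casts the chart form of the background equation of the weighted
`σ₂` path (`backgroundPathOperator_eq_chartOperator`, `GurskyViaclovskyClosednessChartEquation`)
in exactly this shape, on an open subset `U ⊆ ℝ⁴` carrying a Riemannian metric `g` with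
components `G` — the jet function being
`(y, t, J) ↦ chartOperator G t (W y) y (pOf J) (rOf J) − Q(y) e^{4 J₀}`
(`pOf`, `rOf` read the covector and the bilinear form off a coordinate `2`-jet,
`Literature/Analysis/Calculus/CoordinateJets.lean`; `W = |W_g|²`, `Q` the right-hand side):

* `contDiffOn_jetOperator` — the jet function is `C^∞` on `{y ∈ V} × ℝ × CJet` whenever `W`,
  `Q` are `C^∞` on `V` (`contDiffOn_chartOperator_comp`);
* `contDiffOn_of_eq_weylNormSq` — `|W_g|²` read in the chart is `C^∞`
  (`|W|² = |Rm|² − 2|Ric|² + R²/3` and the coordinate expressions `rmNormSqAt`, `normSqAt ∘ ricAt`,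
  `scalAt` are smooth);
* `fderiv_jetOperator_single` — the derivative of the jet function in the rank-one top-jet
  direction `single₂ (η ⊗ η)` is the `r`-derivative of the chart operator in the direction
  `η ⊗ η` (the symbol), by differentiating along the line `J₀ + ε single₂(η⊗η)`
  (`pOf_single_last`, `rOf_single_sq`);
* `jetOperator_cjetOf_eq_zero` — a solution of `backgroundPathOperator g t (−f) = Q e^{4f}` solves
  the jet equation at its coordinate `2`-jet (`pOf_cjetOf`, `rOf_cjetOf`, `cjetOf_zero`);
* `le_fderiv_jetOperator_single` — uniform ellipticity of the jet function along such a solution,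
  in the Euclidean norm of the covector (`symbol_euclid_bounds_along_solution`);
* `exists_frame_bounds` — on a compact subset of `U` the components are bounded, `‖G y‖ ≤ Λ_g`,
  and every `g_y`-orthonormal frame vector has Euclidean length `≤ κ` (uniform positivity of
  `G` on the compact set, `norm_le_sqrt_inv_of_unit`).

The assembly on a closed manifold (constants, radii, the abstract bootstrap, the named fact) is
`GurskyViaclovskyClosednessBootstrap.lean`.

## References

* M. J. Gursky, J. A. Viaclovsky, J. Differential Geom. 63 (2003) 131–154, Prop. 6, §5.
  [GurskyViaclovsky2003]
* D. Gilbarg, N. S. Trudinger, *Elliptic Partial Differential Equations of Second Order* (2001),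
  §17.4 (17.43), Lemma 17.16. [GilbargTrudinger2001]
-/

noncomputable section

set_option maxSynthPendingDepth 3

open scoped Manifold ContDiff Topology
open Set Filter Metric Function Module

namespace Literature.Geometry.Riemannian.GurskyViaclovskyPath

open Literature.Geometry.Lorentzian (PseudoRiemannianMetric)
open Literature.Geometry.Lorentzian.PseudoRiemannianMetric
open Literature.Geometry.Lorentzian
open Literature.Geometry.Lorentzian.MetricCoord
open Literature.Analysis.Calculus

/-! ### Smoothness of the jet function -/

section Smoothness

variable {ι : Type*} [Fintype ι] {E : Type*} [NormedAddCommGroup E] [InnerProductSpace ℝ E]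
  [FiniteDimensional ℝ E] [CompleteSpace E] {G : E → E →L[ℝ] E →L[ℝ] ℝ} {V : Set E}

/-- **The jet function of the chart equation is smooth**: for metric components `G` on `V` and
`W`, `Q` smooth on `V`, the function
`(y, t, J) ↦ chartOperator G t (W y) y (pOf J) (rOf J) − Q(y) e^{4J₀}` is `C^∞` on
`{y ∈ V} × ℝ × CJet ι 2` (`pOf`, `rOf`, `J ↦ J₀` are continuous linear; the chart operator is
jointly smooth, `contDiffOn_chartOperator_comp`). [cite: GilbargTrudinger2001, Lemma 17.16] -/
theorem contDiffOn_jetOperator (bE : OrthonormalBasis ι ℝ E) (hG : IsMetricOn G V) {W Q : E → ℝ}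
    (hW : ContDiffOn ℝ ∞ W V) (hQ : ContDiffOn ℝ ∞ Q V) :
    ContDiffOn ℝ ∞
      (fun x : E × ℝ × CJet ι 2 ↦ chartOperator G x.2.1 (W x.1) x.1 (pOf bE x.2.2) (rOf bE x.2.2) -
        Q x.1 * Real.exp (4 * x.2.2 0 Fin.elim0)) {x | x.1 ∈ V} := by
  have hπ : ContDiffOn ℝ ∞ (fun x : E × ℝ × CJet ι 2 ↦ x.1) {x | x.1 ∈ V} :=
    contDiff_fst.contDiffOn
  have hD : MapsTo (fun x : E × ℝ × CJet ι 2 ↦ x.1) {x | x.1 ∈ V} V := fun _ hx ↦ hx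
  have hp : ContDiffOn ℝ ∞ (fun x : E × ℝ × CJet ι 2 ↦ pOf bE x.2.2) {x | x.1 ∈ V} :=
    ((isBoundedLinearMap_pOf bE).contDiff.comp contDiff_snd.snd).contDiffOn
  have hr : ContDiffOn ℝ ∞ (fun x : E × ℝ × CJet ι 2 ↦ rOf bE x.2.2) {x | x.1 ∈ V} :=
    ((isBoundedLinearMap_rOf bE).contDiff.comp contDiff_snd.snd).contDiffOn
  have h1 := contDiffOn_chartOperator_comp hG contDiff_snd.fst.contDiffOn (hW.comp hπ hD) hπ hD
    hp hr
  have h0 : ContDiff ℝ ∞ (fun J : CJet ι 2 ↦ J 0 Fin.elim0) :=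
    contDiff_pi.1 (contDiff_pi.1 contDiff_id 0) _
  have h2 : ContDiffOn ℝ ∞ (fun x : E × ℝ × CJet ι 2 ↦ Q x.1 * Real.exp (4 * x.2.2 0 Fin.elim0))
      {x | x.1 ∈ V} :=
    (hQ.comp hπ hD).mul
      (Real.contDiff_exp.comp (contDiff_const.mul (h0.comp contDiff_snd.snd))).contDiffOn
  exact h1.sub h2

end Smoothness

/-! ### The jet equation on an open subset of `ℝ⁴` -/

section OpensChart

variable {U : TopologicalSpace.Opens (EuclideanSpace ℝ (Fin 4))}
  (g : PseudoRiemannianMetric 𝓘(ℝ, EuclideanSpace ℝ (Fin 4)) ∞ (EuclideanSpace ℝ (Fin 4))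
    (TangentSpace 𝓘(ℝ, EuclideanSpace ℝ (Fin 4)) : U → Type _))
  [g.HasLeviCivita]
  {G : EuclideanSpace ℝ (Fin 4) →
    EuclideanSpace ℝ (Fin 4) →L[ℝ] EuclideanSpace ℝ (Fin 4) →L[ℝ] ℝ}
  (hG : ∀ y : U, g.val y = G y)

include hG in
/-- **`|W_g|²` is smooth in the chart**: a function `W` on `ℝ⁴` agreeing on `U` with `|W_g|²` is
`C^∞` on `U` — `|W|² = |Rm|² − 2|Ric|² + R²/3` (`weylNormSq_eq_curvNormSqWith`) and the three
terms are the smooth coordinate expressions `rmNormSqAt G`, `normSqAt G (ricAt G)`, `scalAt G`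
of the components. [folklore] -/
theorem contDiffOn_of_eq_weylNormSq (hg : g.IsRiemannian) {W : EuclideanSpace ℝ (Fin 4) → ℝ}
    (hWy : ∀ y : U, W y = g.weylNormSq y) :
    ContDiffOn ℝ ∞ W (U : Set (EuclideanSpace ℝ (Fin 4))) := by
  have hmet : IsMetricOn G (U : Set (EuclideanSpace ℝ (Fin 4))) := OpensChart.isMetricOn_repr hG
  have hE : finrank ℝ (EuclideanSpace ℝ (Fin 4)) = 4 := finrank_euclideanSpace_fin
  have hWc : ContDiffOn ℝ ∞ (fun z ↦ rmNormSqAt G z - 2 * normSqAt G z (ricAt G z) +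
      scalAt G z ^ 2 / 3) (U : Set (EuclideanSpace ℝ (Fin 4))) :=
    (hmet.contDiffOn_rmNormSqAt.sub (contDiffOn_const.mul
      (contDiffOn_normSqAt_comp hmet contDiffOn_id (mapsTo_id _) hmet.contDiffOn_ricAt))).add
      ((hmet.contDiffOn_scalAt.pow 2).div_const 3)
  refine hWc.congr fun z hz ↦ ?_
  rw [hWy ⟨z, hz⟩, g.weylNormSq_eq_curvNormSqWith hg hE,
    OpensChart.curvNormSqWith_eq_rmNormSqAt hG, OpensChart.normSq_ricci_eq_normSqAt hG,
    OpensChart.scalarCurvature_eq_scalAt hG]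

omit [g.HasLeviCivita] in
include hG in
/-- **The derivative of the jet function in a rank-one top-jet direction is the symbol.** At a
point `(y, σ, J₀)`, `y ∈ U`, in the direction `(0, 0, single₂ Ω_η)`,
`Ω_η(I) = η(e_{I 0}) η(e_{I 1})`, the Fréchet derivative of
`(y, t, J) ↦ chartOperator G t (W y) y (pOf J) (rOf J) − Q(y) e^{4J₀}` is the `r`-derivative of
`r ↦ chartOperator G σ (W y) y (pOf J₀) r` at `rOf J₀` in the direction `η ⊗ η`: along the line
`J₀ + ε single₂ Ω_η` the covector `pOf` and the entry `J₀` do not move (`pOf_single_last`) and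
`rOf` moves by `ε η ⊗ η` (`rOf_single_sq`). [cite: GilbargTrudinger2001, §17.4, (17.43)] -/
theorem fderiv_jetOperator_single (bE : OrthonormalBasis (Fin 4) ℝ (EuclideanSpace ℝ (Fin 4)))
    {W Q : EuclideanSpace ℝ (Fin 4) → ℝ}
    (hW : ContDiffOn ℝ ∞ W (U : Set (EuclideanSpace ℝ (Fin 4))))
    (hQ : ContDiffOn ℝ ∞ Q (U : Set (EuclideanSpace ℝ (Fin 4)))) (σ : ℝ) (y : U)
    (J₀ : CJet (Fin 4) 2) (η : EuclideanSpace ℝ (Fin 4) →L[ℝ] ℝ) :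
    fderiv ℝ (fun x : EuclideanSpace ℝ (Fin 4) × ℝ × CJet (Fin 4) 2 ↦
        chartOperator G x.2.1 (W x.1) x.1 (pOf bE x.2.2) (rOf bE x.2.2) -
          Q x.1 * Real.exp (4 * x.2.2 0 Fin.elim0))
      ((y : EuclideanSpace ℝ (Fin 4)), σ, J₀)
      ((0 : EuclideanSpace ℝ (Fin 4)), (0 : ℝ),
        Pi.single (Fin.last 2) (fun I : Fin 2 → Fin 4 ↦ η (bE (I 0)) * η (bE (I 1)))) =
      fderiv ℝ (fun r ↦ chartOperator G σ (W y) y (pOf bE J₀) r) (rOf bE J₀) (η.smulRight η) := by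
  set Φ := fun x : EuclideanSpace ℝ (Fin 4) × ℝ × CJet (Fin 4) 2 ↦
    chartOperator G x.2.1 (W x.1) x.1 (pOf bE x.2.2) (rOf bE x.2.2) -
      Q x.1 * Real.exp (4 * x.2.2 0 Fin.elim0) with hΦ
  set δJ : CJet (Fin 4) 2 :=
    Pi.single (Fin.last 2) (fun I : Fin 2 → Fin 4 ↦ η (bE (I 0)) * η (bE (I 1))) with hδJ
  set v : EuclideanSpace ℝ (Fin 4) × ℝ × CJet (Fin 4) 2 := (0, 0, δJ) with hv
  set x₀ : EuclideanSpace ℝ (Fin 4) × ℝ × CJet (Fin 4) 2 := ((y : EuclideanSpace ℝ (Fin 4)), σ, J₀)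
    with hx₀
  have hmet : IsMetricOn G (U : Set (EuclideanSpace ℝ (Fin 4))) := OpensChart.isMetricOn_repr hG
  -- the jet function is differentiable at `x₀`
  have hopen : IsOpen {x : EuclideanSpace ℝ (Fin 4) × ℝ × CJet (Fin 4) 2 |
      x.1 ∈ (U : Set (EuclideanSpace ℝ (Fin 4)))} := U.2.preimage continuous_fst
  have hdΦ : DifferentiableAt ℝ Φ x₀ :=
    ((contDiffOn_jetOperator bE hmet hW hQ).differentiableOn (by simp)).differentiableAt
      (hopen.mem_nhds y.2)
  -- the jet function along the line `x₀ + ε v`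
  have hlp := (isBoundedLinearMap_pOf bE).toIsLinearMap
  have hlr := (isBoundedLinearMap_rOf bE).toIsLinearMap
  have hline : ∀ ε : ℝ, Φ (x₀ + ε • v) =
      chartOperator G σ (W y) y (pOf bE J₀) (rOf bE J₀ + ε • η.smulRight η) -
        Q y * Real.exp (4 * J₀ 0 Fin.elim0) := by
    intro ε
    have h1 : x₀ + ε • v = ((y : EuclideanSpace ℝ (Fin 4)), σ, J₀ + ε • δJ) := by
      simp only [hx₀, hv, Prod.smul_mk, smul_zero, Prod.mk_add_mk, add_zero]
    have hp : pOf bE (J₀ + ε • δJ) = pOf bE J₀ := by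
      rw [hlp.map_add, hlp.map_smul, hδJ, pOf_single_last, smul_zero, add_zero]
    have hr : rOf bE (J₀ + ε • δJ) = rOf bE J₀ + ε • η.smulRight η := by
      rw [hlr.map_add, hlr.map_smul, hδJ, rOf_single_sq]
    have h0 : (J₀ + ε • δJ) 0 Fin.elim0 = J₀ 0 Fin.elim0 := by
      have hz : δJ 0 = 0 := by rw [hδJ]; exact Pi.single_eq_of_ne (by decide) _
      have hz' : (ε • δJ) 0 Fin.elim0 = 0 := by
        rw [Pi.smul_apply, hz, smul_zero]
        rfl
      rw [Pi.add_apply, Pi.add_apply, hz', add_zero]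
    rw [h1]
    show chartOperator G σ (W y) y (pOf bE (J₀ + ε • δJ)) (rOf bE (J₀ + ε • δJ)) -
      Q y * Real.exp (4 * (J₀ + ε • δJ) 0 Fin.elim0) = _
    rw [hp, hr, h0]
  -- differentiate along the line in two ways
  have hℓ : HasDerivAt (fun ε : ℝ ↦ x₀ + ε • v) v 0 := by
    simpa using ((hasDerivAt_id (0 : ℝ)).smul_const v).const_add x₀
  have hd1 : HasDerivAt (fun ε : ℝ ↦ Φ (x₀ + ε • v)) (fderiv ℝ Φ x₀ v) 0 :=
    hdΦ.hasFDerivAt.comp_hasDerivAt_of_eq (0 : ℝ) hℓ (by simp)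
  have hdψ : DifferentiableAt ℝ (fun r ↦ chartOperator G σ (W y) y (pOf bE J₀) r) (rOf bE J₀) :=
    ((contDiff_chartOperator_right g hG σ (W y) y (pOf bE J₀)).differentiable
      (by simp)).differentiableAt
  have hℓ' : HasDerivAt (fun ε : ℝ ↦ rOf bE J₀ + ε • η.smulRight η) (η.smulRight η) 0 := by
    simpa using ((hasDerivAt_id (0 : ℝ)).smul_const (η.smulRight η)).const_add (rOf bE J₀)
  have hd2 : HasDerivAt (fun ε : ℝ ↦
      chartOperator G σ (W y) y (pOf bE J₀) (rOf bE J₀ + ε • η.smulRight η) -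
        Q y * Real.exp (4 * J₀ 0 Fin.elim0))
      (fderiv ℝ (fun r ↦ chartOperator G σ (W y) y (pOf bE J₀) r) (rOf bE J₀) (η.smulRight η)) 0 :=
    (hdψ.hasFDerivAt.comp_hasDerivAt_of_eq (0 : ℝ) hℓ' (by simp)).sub_const _
  rw [funext hline] at hd1
  exact hd1.unique hd2

include hG in
/-- **A solution of the background equation solves the jet equation at its coordinate `2`-jet.**
If `backgroundPathOperator g t (−f) y = Q(y) e^{−4(−f y)}` for a smooth `f : U → ℝ` with `C²`
representative `F`, and `W y = |W_g|²(y)`, then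
`chartOperator G t (W y) y (pOf (cjet₂F(y))) (rOf (cjet₂F(y))) − Q(y) e^{4 (cjet₂F(y))₀} = 0`
(`backgroundPathOperator_eq_chartOperator`, `pOf_cjetOf`, `rOf_cjetOf`, `cjetOf_zero`).
[cite: GurskyViaclovsky2003, §1 (change1)–(PDE) and Prop. 6] -/
theorem jetOperator_cjetOf_eq_zero (hg : g.IsRiemannian)
    (bE : OrthonormalBasis (Fin 4) ℝ (EuclideanSpace ℝ (Fin 4)))
    {W Q : EuclideanSpace ℝ (Fin 4) → ℝ} (t : ℝ) {f : U → ℝ}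
    (hf : ContMDiff 𝓘(ℝ, EuclideanSpace ℝ (Fin 4)) 𝓘(ℝ) ∞ f) {F : EuclideanSpace ℝ (Fin 4) → ℝ}
    (hfF : ∀ y : U, f y = F y) (y : U) (hF : ContDiffAt ℝ 2 F y) (hWy : W y = g.weylNormSq y)
    (heq : backgroundPathOperator g t (fun z ↦ -f z) y = Q y * Real.exp (-4 * (-f y))) :
    chartOperator G t (W y) y (pOf bE (cjetOf bE 2 F y)) (rOf bE (cjetOf bE 2 F y)) -
      Q y * Real.exp (4 * cjetOf bE 2 F y 0 Fin.elim0) = 0 := by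
  rw [pOf_cjetOf, rOf_cjetOf bE hF, cjetOf_zero, hWy,
    ← backgroundPathOperator_eq_chartOperator g hG hg t hf hfF y hF, heq, hfF y, sub_eq_zero]
  congr 1
  ring_nf

include hG in
/-- **Uniform ellipticity of the jet function along a solution** (Gilbarg–Trudinger's structure
condition (17.43) for the chart form of the weighted `σ₂` path equation, in the Euclidean norm of
the covector): with the hypotheses of `symbol_euclid_bounds_along_solution` at `y ∈ U` — the
background equation with right side `q e^{4f}`, `q ≥ q₀ > 0`, admissibility, `t ≤ 1`, `|t| ≤ T`,
the covariant bounds `|f|, |∇f|², |∇²f|² ≤ C`, `|Ric|² ≤ P²`, `|R| ≤ P`, a `g_y`-orthonormal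
frame of Euclidean length `≤ κ` and `‖G y‖ ≤ Λ_g` — the derivative of the jet function at
`(y, t, cjet₂F(y))` in the direction `(0, 0, single₂ Ω_η)` is at least `λ_E ‖η‖²`,
`λ_E = 4λ/(4(Λ_gκ)²)` with the constant `λ(q₀, C, P, T)` of `uniformlyElliptic_along_solution`
(Gilbarg–Trudinger's (17.43) for this equation). [cite: GurskyViaclovsky2003, Prop. 6 (proof)] -/
theorem le_fderiv_jetOperator_single (hg : g.IsRiemannian)
    (bE : OrthonormalBasis (Fin 4) ℝ (EuclideanSpace ℝ (Fin 4)))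
    {W Q : EuclideanSpace ℝ (Fin 4) → ℝ}
    (hW : ContDiffOn ℝ ∞ W (U : Set (EuclideanSpace ℝ (Fin 4))))
    (hQ : ContDiffOn ℝ ∞ Q (U : Set (EuclideanSpace ℝ (Fin 4)))) {f : U → ℝ}
    (hf : ContMDiff 𝓘(ℝ, EuclideanSpace ℝ (Fin 4)) 𝓘(ℝ) ∞ f) {F : EuclideanSpace ℝ (Fin 4) → ℝ}
    (hfF : ∀ y : U, f y = F y) {q : U → ℝ} {t q₀ C P T : ℝ} (ht : t ≤ 1) (htT : |t| ≤ T)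
    (hq₀ : 0 < q₀) (hC : 0 ≤ C) (hP : 0 ≤ P) (y : U) (hF : ContDiffAt ℝ 2 F y) (hqy : q₀ ≤ q y)
    (heq : backgroundPathOperator g t (fun z ↦ -f z) y = q y * Real.exp (-4 * (-f y)))
    (hpos : 0 < backgroundScalar g (fun z ↦ -f z) y)
    (hfy : |f y| ≤ C) (hgrad : g.gradSq f y ≤ C) (hhess : g.normSq y (g.hessian f y) ≤ C)
    (hRic : g.normSq y (g.ricci y) ≤ P ^ 2) (hR : |g.scalarCurvature y| ≤ P)
    {b : Basis (Fin 4) ℝ (TangentSpace 𝓘(ℝ, EuclideanSpace ℝ (Fin 4)) y)}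
    (hb : g.IsOrthonormalFrame y b) {κ Λg : ℝ} (hκ0 : 0 ≤ κ)
    (hκ : ∀ a, @norm (EuclideanSpace ℝ (Fin 4)) _ (b a) ≤ κ) (hΛg : ‖G y‖ ≤ Λg)
    (η : EuclideanSpace ℝ (Fin 4) →L[ℝ] ℝ) :
    4 * (q₀ * Real.exp (-4 * C) / 4 /
          (2 * (4 * ((1 + T) * P + (3 + 2 * T) * Real.sqrt C + (5 + 2 * T) * C) + 1))) /
        ((Λg * κ) ^ 2 * 4) * ‖η‖ ^ 2 ≤
      fderiv ℝ (fun x : EuclideanSpace ℝ (Fin 4) × ℝ × CJet (Fin 4) 2 ↦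
          chartOperator G x.2.1 (W x.1) x.1 (pOf bE x.2.2) (rOf bE x.2.2) -
            Q x.1 * Real.exp (4 * x.2.2 0 Fin.elim0))
        ((y : EuclideanSpace ℝ (Fin 4)), t, cjetOf bE 2 F y)
        ((0 : EuclideanSpace ℝ (Fin 4)), (0 : ℝ),
          Pi.single (Fin.last 2) (fun I : Fin 2 → Fin 4 ↦ η (bE (I 0)) * η (bE (I 1)))) := by
  rw [fderiv_jetOperator_single g hG bE hW hQ t y _ η, pOf_cjetOf, rOf_cjetOf bE hF]
  exact (symbol_euclid_bounds_along_solution g hG hg hf hfF ht htT hq₀ hC hP y hF hqy heq hpos hfy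
    hgrad hhess hRic hR hb hκ0 hκ hΛg (W y) η).1

omit [g.HasLeviCivita] in
include hG in
/-- **Frame and coefficient bounds on a compact subset of the chart.** For a Riemannian `g` on
`U ⊆ ℝ⁴` with components `G` and a compact `K ⊆ U` there are `κ, Λ_g > 0` with `‖G y‖ ≤ Λ_g` on
`K` and `‖b_a‖ ≤ κ` for every `g_y`-orthonormal frame `b` at a point `y ∈ K` (uniform positivity
`λ‖v‖² ≤ G_y(v, v)` on `K` by compactness of `K × 𝕊³`, and `κ = λ^{-1/2}`). [folklore] -/
theorem exists_frame_bounds (hg : g.IsRiemannian) {K : Set (EuclideanSpace ℝ (Fin 4))}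
    (hK : IsCompact K) (hKU : K ⊆ (U : Set (EuclideanSpace ℝ (Fin 4)))) :
    ∃ κ Λg : ℝ, 0 < κ ∧ 0 < Λg ∧ ∀ y : U, (y : EuclideanSpace ℝ (Fin 4)) ∈ K →
      ‖G y‖ ≤ Λg ∧
      ∀ {b : Basis (Fin 4) ℝ (TangentSpace 𝓘(ℝ, EuclideanSpace ℝ (Fin 4)) y)},
        g.IsOrthonormalFrame y b → ∀ a, @norm (EuclideanSpace ℝ (Fin 4)) _ (b a) ≤ κ := by
  have hmet : IsMetricOn G (U : Set (EuclideanSpace ℝ (Fin 4))) := OpensChart.isMetricOn_repr hG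
  have hGpos : ∀ (y : U) (v : EuclideanSpace ℝ (Fin 4)), v ≠ 0 → 0 < G y v v := fun y v hv ↦ by
    rw [← hG]
    exact hg y v hv
  rcases K.eq_empty_or_nonempty with rfl | ⟨z₀, hz₀⟩
  · exact ⟨1, 1, one_pos, one_pos, fun y hy ↦ (Set.notMem_empty _ hy).elim⟩
  have hGcont := hmet.contDiffOn.continuousOn.mono hKU
  obtain ⟨Λ, hΛ⟩ := hK.exists_bound_of_continuousOn
    (E := EuclideanSpace ℝ (Fin 4) →L[ℝ] EuclideanSpace ℝ (Fin 4) →L[ℝ] ℝ) hGcont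
  -- uniform positivity on `K`: the minimum of `G y (v, v)` over `K × unit sphere`
  set f : EuclideanSpace ℝ (Fin 4) × EuclideanSpace ℝ (Fin 4) → ℝ := fun p ↦ G p.1 p.2 p.2
    with hf
  have hS : IsCompact (K ×ˢ sphere (0 : EuclideanSpace ℝ (Fin 4)) 1) :=
    hK.prod (isCompact_sphere 0 1)
  have hSne : (K ×ˢ sphere (0 : EuclideanSpace ℝ (Fin 4)) 1).Nonempty :=
    ⟨(z₀, EuclideanSpace.single 0 1), hz₀, by simp⟩
  have hfc : ContinuousOn f (K ×ˢ sphere (0 : EuclideanSpace ℝ (Fin 4)) 1) := by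
    have h1 := hGcont.comp continuous_fst.continuousOn
      fun p (hp : p ∈ K ×ˢ sphere (0 : EuclideanSpace ℝ (Fin 4)) 1) ↦ hp.1
    exact (h1.clm_apply continuous_snd.continuousOn).clm_apply continuous_snd.continuousOn
  obtain ⟨p₀, hp₀, hmin⟩ := hS.exists_isMinOn hSne hfc
  set lam : ℝ := f p₀ with hlam
  have hlam0 : 0 < lam := by
    have hv0 : p₀.2 ≠ 0 := by
      intro h0
      have h := hp₀.2
      rw [mem_sphere_zero_iff_norm, h0, norm_zero] at h
      exact zero_ne_one h
    exact hGpos ⟨p₀.1, hKU hp₀.1⟩ p₀.2 hv0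
  have hposK : ∀ y ∈ K, ∀ v : EuclideanSpace ℝ (Fin 4), lam * ‖v‖ ^ 2 ≤ G y v v := by
    intro y hy v
    by_cases hv : v = 0
    · simp [hv]
    · have hn : 0 < ‖v‖ := norm_pos_iff.2 hv
      set w : EuclideanSpace ℝ (Fin 4) := ‖v‖⁻¹ • v with hw
      have hws : w ∈ sphere (0 : EuclideanSpace ℝ (Fin 4)) 1 := by
        rw [mem_sphere_zero_iff_norm, hw, norm_smul, norm_inv, norm_norm, inv_mul_cancel₀ hn.ne']
      have hmin' : lam ≤ G y w w := isMinOn_iff.1 hmin (y, w) ⟨hy, hws⟩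
      have hvw : v = ‖v‖ • w := by
        rw [hw, smul_smul, mul_inv_cancel₀ hn.ne', one_smul]
      calc lam * ‖v‖ ^ 2 ≤ G y w w * ‖v‖ ^ 2 :=
            mul_le_mul_of_nonneg_right hmin' (by positivity)
        _ = G y v v := by
            conv_rhs => rw [hvw, bilin_smul_smul (G y) ‖v‖ w]
            ring
  refine ⟨Real.sqrt lam⁻¹, max Λ 1, Real.sqrt_pos.2 (inv_pos.2 hlam0),
    lt_max_of_lt_right one_pos, fun y hy ↦ ⟨(hΛ y hy).trans (le_max_left _ _), fun hb a ↦ ?_⟩⟩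
  refine norm_le_sqrt_inv_of_unit (G y) hlam0 (hposK y hy) ?_
  have h1 := hb.1 a
  rw [hG] at h1
  exact h1

end OpensChart

end Literature.Geometry.Riemannian.GurskyViaclovskyPath

end
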